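import Literature.MathematicalPhysics.KineticTheory.DiPernaLionsExtraction
import Literature.Analysis.FunctionSpaces.WeakCompactnessL1Proofs
import HarnessLib

/-!
# Extraction of the DiPerna–Lions weak limit: assembly of (B1)

Topic: MathematicalPhysics / KineticTheory. Proofs-only companion of
`Literature.MathematicalPhysics.KineticTheory.DiPernaLionsExtraction`, completing the reduction of
the named fact (B1) `Kinetic.diPernaLions_extraction` of
`Literature.MathematicalPhysics.KineticTheory.DiPernaLionsLimit` (Cercignani–Illner–Pulvirenti
1994 §5.3 Step 10, pp. 151–152; Lions 1993 Thm III.4 / Rem. III.8) to the single equicontinuity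
fact `Kinetic.diPernaLions_approx_equicontinuous` (CIP Step 10):

* `Kinetic.tendstoWeaklyL1_slab_of_slices` (**proved**): weak convergence of every slice
  (with uniform mass bounds) gives weak convergence on every slab (dominated convergence in `t`
  and Fubini);
* `Kinetic.HasDiPernaLionsData.aestronglyMeasurable` (**proved**): a datum with
  `∫⁻ f₀ (1 + |x|² + |v|² + |log f₀|) < ∞` is a.e.-strongly measurable (the weight
  `u ↦ u (a + |log u|)` is strictly increasing on `[0, ∞)` for `a ≥ 1`, so `f₀` is a countable
  supremum of measurable functions a.e.);
* `Kinetic.slice_limits_uniformly_continuous` (**proved**; Heine–Cantor in `L¹`);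
  `Kinetic.slice_zero_ae_eq_data` (**proved**; Lions 1993 Rem. III.8: the slice at `0` of the
  weak limit is `f₀`, by strong `L¹` convergence of the data and uniqueness of weak limits);
* `Kinetic.exists_measurable_representative` (**proved**): an `L¹`-continuous family of slices
  `t ↦ f_t` has a jointly Borel, everywhere nonnegative representative `F` with `F t = f_t` a.e.
  for *every* `t ≥ 0` (dyadic sampling + fast `L¹` convergence + `liminf`);
* `Kinetic.diPernaLions_extraction_of` (**proved**): (B1) `Kinetic.diPernaLions_extraction`
  follows from the Dunford–Pettis fact `Literature.Analysis.FunctionSpaces.dunfordPettis_exists_subseq` and the equicontinuity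
  fact `Kinetic.diPernaLions_approx_equicontinuous`; since the Dunford–Pettis theorem is proved
  (`Literature.Analysis.FunctionSpaces.dunfordPettis_exists_subseq_holds`,
  `Literature.Analysis.FunctionSpaces.WeakCompactnessL1Proofs`),
  `Kinetic.diPernaLions_extraction_of_equicontinuous` derives **(B1) from the equicontinuity
  fact alone**.

State of the decomposition of `Hilbert6.diperna_lions` after this file: `diperna_lions` ⇐
(A) + (B) (`DiPernaLionsStability`, proved); (A) ⇐ A1, A2a–c, A3a–b (`DiPernaLionsScheme`,
proved); (B) ⇐ B1, S14, D5, B3 (`DiPernaLionsLimit`, proved); D5 proved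
(`DiPernaLionsLimitProofs`); S14 ⇐ E49, L12 (`DiPernaLionsMildLimitProofs`, proved); B1 ⇐ EQ
(this file). Remaining named facts: A1, A2a, A2b, A2c, A3a, A3b, EQ, B3, E49, L12.

## References
* C. Cercignani, R. Illner, M. Pulvirenti, *The Mathematical Theory of Dilute Gases*, Springer
  1994, §5.3 Step 10. [cite: CIPDiluteGases1994, §5.3 Step 10 (pp. 151–152)]
* P.-L. Lions, *Global solutions of kinetic models and related questions*, LNM 1551 (1993),
  Thm III.4, Rem. III.8. [cite: Lions1993Kinetic, Thm III.4]
* R. J. DiPerna, P.-L. Lions, Ann. of Math. 130 (1989) 321–366. [cite: DiPernaLionsAnnals1989, §IV]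
-/

open MeasureTheory Metric Real Set Filter Topology
open scoped InnerProductSpace ENNReal

noncomputable section

namespace Literature.MathematicalPhysics.KineticTheory

variable {E : Type*} [NormedAddCommGroup E] [InnerProductSpace ℝ E] [FiniteDimensional ℝ E]
  [MeasurableSpace E] [BorelSpace E]

/-- Integrability on a slab of a density with slice mass bounds, times a bounded multiplier.
[folklore] -/
theorem integrable_slab_mul_of_mass_le {u : ℝ × E × E → ℝ} {T : ℝ}
    (hu : AEStronglyMeasurable u (slabMeasure E T)) (hu0 : ∀ t ∈ Ioo 0 T, ∀ z : E × E, 0 ≤ u (t, z))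
    {M : ℝ} (hM : ∀ t ∈ Ioo 0 T, ∫⁻ z, ENNReal.ofReal (u (t, z)) ∂((volume : Measure E).prod volume) ≤
      ENNReal.ofReal M)
    {Ψ : ℝ × E × E → ℝ} (hΨm : Measurable Ψ) {C : ℝ} (hC : ∀ q, |Ψ q| ≤ C) :
    Integrable (fun q => u q * Ψ q) (slabMeasure E T) := by
  have hC0 : 0 ≤ C := (abs_nonneg _).trans (hC (0, 0))
  have hint : Integrable u (slabMeasure E T) := by
    refine ⟨hu, ?_⟩
    rw [HasFiniteIntegral]
    rcases le_or_gt T 0 with hT | hT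
    · rw [slabMeasure_def, Ioo_eq_empty (not_lt.2 hT), empty_prod, Measure.restrict_empty,
        lintegral_zero_measure]
      exact ENNReal.zero_lt_top
    calc ∫⁻ q, ‖u q‖ₑ ∂(slabMeasure E T) ≤ ENNReal.ofReal T * ENNReal.ofReal M := by
          refine lintegral_slab_le hu.aemeasurable.enorm fun t ht => ?_
          calc ∫⁻ z, ‖u (t, z)‖ₑ ∂((volume : Measure E).prod volume)
              = ∫⁻ z, ENNReal.ofReal (u (t, z)) ∂((volume : Measure E).prod volume) :=
                lintegral_congr fun z => Real.enorm_eq_ofReal (hu0 t ht z)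
            _ ≤ ENNReal.ofReal M := hM t ht
      _ < ⊤ := ENNReal.mul_lt_top ENNReal.ofReal_lt_top ENNReal.ofReal_lt_top
  exact hint.mul_bdd hΨm.aestronglyMeasurable (ae_of_all _ fun q => (Real.norm_eq_abs _).le.trans (hC q))

/-- **Weak convergence on slabs from weak convergence of the slices** (dominated convergence in
time and Fubini): if every time slice of a sequence of densities with uniform mass bounds
converges weakly in `L¹(E × E)` to the corresponding slice of a measurable `F` with finite slice
masses, then the sequence converges weakly in `L¹((0,T) × E × E)` to `F`. [folklore] -/
theorem tendstoWeaklyL1_slab_of_slices {fs : ℕ → ℝ → E → E → ℝ} {F : ℝ → E → E → ℝ}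
    (hcont : ∀ k, ContinuousOn (fun z : ℝ × E × E => fs k z.1 z.2.1 z.2.2) (Ici 0 ×ˢ univ))
    (hnn : ∀ k, ∀ t ≥ (0 : ℝ), ∀ x v, 0 ≤ fs k t x v)
    (hmass : ∀ T ≥ (0 : ℝ), ∃ M : ℝ, ∀ k, ∀ t ∈ Icc 0 T,
      ∫⁻ z, ENNReal.ofReal (fs k t z.1 z.2) ∂((volume : Measure E).prod volume) ≤ ENNReal.ofReal M)
    (hFm : Measurable fun z : ℝ × E × E => F z.1 z.2.1 z.2.2)
    (hF0 : ∀ t ≥ (0 : ℝ), ∀ x v, 0 ≤ F t x v)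
    (hFmass : ∀ T ≥ (0 : ℝ), ∃ M : ℝ, ∀ t ∈ Icc 0 T,
      ∫⁻ z, ENNReal.ofReal (F t z.1 z.2) ∂((volume : Measure E).prod volume) ≤ ENNReal.ofReal M)
    (hslice : ∀ t ≥ (0 : ℝ), Literature.Analysis.FunctionSpaces.TendstoWeaklyL1 (fun k (z : E × E) => fs k t z.1 z.2)
      (fun z => F t z.1 z.2) (volume.prod volume))
    (T : ℝ) :
    Literature.Analysis.FunctionSpaces.TendstoWeaklyL1 (fun k (q : ℝ × E × E) => fs k q.1 q.2.1 q.2.2)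
      (fun q => F q.1 q.2.1 q.2.2) (slabMeasure E T) := by
  refine tendstoWeaklyL1_of_forall_measurable fun Ψ C hΨm hC => ?_
  have hC0 : 0 ≤ C := (abs_nonneg _).trans (hC (0, 0))
  rcases le_or_gt T 0 with hT | hT
  · have hzero : slabMeasure E T = 0 := by
      rw [slabMeasure_def, Ioo_eq_empty (not_lt.2 hT), empty_prod, Measure.restrict_empty]
    simp only [hzero, integral_zero_measure]
    exact tendsto_const_nhds
  obtain ⟨M₁, hM₁⟩ := hmass T hT.le
  obtain ⟨M₂, hM₂⟩ := hFmass T hT.le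
  set M : ℝ := max (max M₁ M₂) 0 with hMdef
  have hM0 : 0 ≤ M := le_max_right _ _
  have hM₁' : ∀ k, ∀ t ∈ Icc 0 T, ∫⁻ z, ENNReal.ofReal (fs k t z.1 z.2)
      ∂((volume : Measure E).prod volume) ≤ ENNReal.ofReal M := fun k t ht =>
    (hM₁ k t ht).trans (ENNReal.ofReal_le_ofReal ((le_max_left _ _).trans (le_max_left _ _)))
  have hM₂' : ∀ t ∈ Icc 0 T, ∫⁻ z, ENNReal.ofReal (F t z.1 z.2)
      ∂((volume : Measure E).prod volume) ≤ ENNReal.ofReal M := fun t ht =>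
    (hM₂ t ht).trans (ENNReal.ofReal_le_ofReal ((le_max_right _ _).trans (le_max_left _ _)))
  -- integrability on the slab
  have hIk : ∀ k, Integrable (fun q : ℝ × E × E => fs k q.1 q.2.1 q.2.2 * Ψ q) (slabMeasure E T) := by
    intro k
    refine integrable_slab_mul_of_mass_le ?_ (fun t ht z => hnn k t ht.1.le _ _)
      (fun t ht => hM₁' k t ⟨ht.1.le, ht.2.le⟩) hΨm hC
    rw [slabMeasure_def]
    exact ((hcont k).mono (Set.prod_mono (fun t ht => le_of_lt ht.1) Subset.rfl)).aestronglyMeasurable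
      (measurableSet_Ioo.prod MeasurableSet.univ)
  have hIF : Integrable (fun q : ℝ × E × E => F q.1 q.2.1 q.2.2 * Ψ q) (slabMeasure E T) :=
    integrable_slab_mul_of_mass_le hFm.aestronglyMeasurable (fun t ht z => hF0 t ht.1.le _ _)
      (fun t ht => hM₂' t ⟨ht.1.le, ht.2.le⟩) hΨm hC
  -- Fubini
  have hprod : ∀ {u : ℝ × E × E → ℝ}, Integrable u (slabMeasure E T) →
      ∫ q, u q ∂(slabMeasure E T) = ∫ t in Ioo 0 T, ∫ z, u (t, z) ∂((volume : Measure E).prod volume) := by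
    intro u hu
    rw [slabMeasure_eq_prod] at hu ⊢
    exact integral_prod _ hu
  rw [hprod hIF]
  have heq : (fun k => ∫ q, fs k q.1 q.2.1 q.2.2 * Ψ q ∂(slabMeasure E T)) = fun k =>
      ∫ t in Ioo 0 T, ∫ z, fs k t z.1 z.2 * Ψ (t, z) ∂((volume : Measure E).prod volume) :=
    funext fun k => hprod (hIk k)
  rw [heq]
  -- dominated convergence in `t`
  refine tendsto_integral_of_dominated_convergence (fun _ => C * M) ?_ (integrableOn_const ?_) ?_ ?_
  · intro k
    have := (hIk k)
    rw [slabMeasure_eq_prod] at this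
    exact this.integral_prod_left.1
  · rw [Real.volume_Ioo]; exact ENNReal.ofReal_ne_top
  · intro k
    filter_upwards [ae_restrict_mem measurableSet_Ioo] with t ht
    rw [Real.norm_eq_abs]
    have hint := (integrable_slice_and_sharp (hcont k) (hnn k) ht.1.le (hM₁' k t ⟨ht.1.le, ht.2.le⟩)).1
    calc |∫ z, fs k t z.1 z.2 * Ψ (t, z) ∂((volume : Measure E).prod volume)|
        ≤ C * ∫ z, fs k t z.1 z.2 ∂((volume : Measure E).prod volume) :=
          abs_integral_mul_le_of_abs_le hint (fun z => hnn k t ht.1.le _ _) (fun z => hC _)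
      _ ≤ C * M := by
          refine mul_le_mul_of_nonneg_left ?_ hC0
          rw [integral_eq_lintegral_of_nonneg_ae (ae_of_all _ fun z => hnn k t ht.1.le _ _) hint.1]
          exact ENNReal.toReal_le_of_le_ofReal hM0 (hM₁' k t ⟨ht.1.le, ht.2.le⟩)
  · filter_upwards [ae_restrict_mem measurableSet_Ioo] with t ht
    exact hslice t ht.1.le (fun z => Ψ (t, z)) C (hΨm.comp (measurable_const.prodMk measurable_id)).aestronglyMeasurable
      (ae_of_all _ fun z => hC _)

end Literature.MathematicalPhysics.KineticTheory

namespace Literature.MathematicalPhysics.KineticTheory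

/-- Tangent inequality for `x log x`: `(1 + log v) u - v ≤ u log u` for `u ≥ 0`, `v > 0`. [folklore] -/
theorem tangent_le_mul_log {u v : ℝ} (hu : 0 ≤ u) (hv : 0 < v) : (1 + log v) * u - v ≤ u * log u := by
  rcases eq_or_lt_of_le hu with rfl | hu0
  · simp [hv.le]
  have key : 1 - v / u ≤ log (u / v) := by
    have := one_sub_inv_le_log_of_pos (div_pos hu0 hv)
    rwa [inv_div] at this
  rw [log_div hu0.ne' hv.ne'] at key
  have := mul_le_mul_of_nonneg_left key hu
  have hsimp : u * (1 - v / u) = u - v := by field_simp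
  rw [hsimp] at this
  nlinarith

/-- For the entropy weight `G_a(u) = u (a + |log u|)` on `[0, 1]`:
`G_a(v) - G_a(u) ≥ (v - u)(a - 1 - log v)` for `0 ≤ u ≤ v ≤ 1`, `0 < v`. [folklore] -/
theorem entropyWeight_sub_ge {a u v : ℝ} (hu : 0 ≤ u) (huv : u ≤ v) (hv1 : v ≤ 1) (hv : 0 < v) :
    (v - u) * (a - 1 - log v) ≤ v * (a + |log v|) - u * (a + |log u|) := by
  have hlogv : log v ≤ 0 := log_nonpos hv.le hv1
  have hlogu : log u ≤ 0 := by
    rcases eq_or_lt_of_le hu with rfl | hu0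
    · simp
    · exact log_nonpos hu (huv.trans hv1)
  rw [abs_of_nonpos hlogv, abs_of_nonpos hlogu]
  have := tangent_le_mul_log hu hv
  nlinarith

/-- For `a ≥ 1`, the entropy weight `G_a(u) = u (a + |log u|)` is strictly increasing on
`[0, ∞)`. [folklore] -/
theorem strictMonoOn_entropyWeight {a : ℝ} (ha : 1 ≤ a) :
    StrictMonoOn (fun u : ℝ => u * (a + |log u|)) (Ici 0) := by
  -- strict increase on `[0,1]`
  have h01 : ∀ u v : ℝ, 0 ≤ u → u < v → v ≤ 1 → u * (a + |log u|) < v * (a + |log v|) := by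
    intro u v hu huv hv1
    set m : ℝ := (u + v) / 2 with hm
    have hum : u < m := by rw [hm]; linarith
    have hmv : m < v := by rw [hm]; linarith
    have hm0 : 0 < m := by linarith
    have hm1 : m < 1 := by linarith
    have h1 := entropyWeight_sub_ge (a := a) hu hum.le (by linarith) hm0
    have h2 := entropyWeight_sub_ge (a := a) hm0.le hmv.le hv1 (by linarith)
    have hlogm : log m < 0 := log_neg hm0 hm1
    have hlogv : log v ≤ 0 := log_nonpos (by linarith) hv1
    nlinarith [mul_pos (sub_pos.2 hum) (by linarith : (0 : ℝ) < a - 1 - log m),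
      mul_nonneg (sub_pos.2 hmv).le (by linarith : (0 : ℝ) ≤ a - 1 - log v)]
  -- strict increase on `[1, ∞)`
  have h1i : ∀ u v : ℝ, 1 ≤ u → u < v → u * (a + |log u|) < v * (a + |log v|) := by
    intro u v hu huv
    have hlogu : 0 ≤ log u := log_nonneg hu
    have hlogv : 0 ≤ log v := log_nonneg (by linarith)
    rw [abs_of_nonneg hlogu, abs_of_nonneg hlogv]
    have hll : log u ≤ log v := log_le_log (by linarith) huv.le
    nlinarith [mul_le_mul huv.le hll hlogu (by linarith : (0 : ℝ) ≤ v)]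
  intro u hu v hv huv
  simp only [mem_Ici] at hu hv
  show u * (a + |log u|) < v * (a + |log v|)
  rcases le_or_gt v 1 with hv1 | hv1
  · exact h01 u v hu huv hv1
  · rcases lt_or_ge u 1 with hu1 | hu1
    · exact (h01 u 1 hu hu1 le_rfl).trans (h1i 1 v le_rfl hv1)
    · exact h1i u v hu1 huv

variable {E : Type*} [NormedAddCommGroup E] [InnerProductSpace ℝ E] [FiniteDimensional ℝ E]
  [MeasurableSpace E] [BorelSpace E]

/-- **DiPerna–Lions data are a.e. strongly measurable**: integrability of
`f₀ (1 + |x|² + |v|² + |log f₀|)` determines `f₀ ≥ 0` as a monotone function of a measurable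
quantity (`u ↦ u (a + |log u|)` is strictly increasing on `[0,∞)` for `a ≥ 1`), so `f₀` is
a.e. equal to a Borel function. [folklore] -/
theorem _root_.Literature.Analysis.FluidPDE.HasDiPernaLionsData.aestronglyMeasurable {f₀ : E → E → ℝ} (h : Literature.Analysis.FluidPDE.HasDiPernaLionsData f₀) :
    AEStronglyMeasurable (fun z : E × E => f₀ z.1 z.2) (volume.prod volume) := by
  obtain ⟨h0, hI⟩ := h
  set w : E × E → ℝ := fun z => 1 + ‖z.1‖ ^ 2 + ‖z.2‖ ^ 2 with hw
  have hwm : Measurable w :=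
    (measurable_const.add (measurable_fst.norm.pow_const 2)).add (measurable_snd.norm.pow_const 2)
  have hw1 : ∀ z, 1 ≤ w z := fun z => by nlinarith [sq_nonneg ‖z.1‖, sq_nonneg ‖z.2‖]
  -- the integrand `H = G_{w}(f₀)` and a Borel version
  let G : ℝ → ℝ → ℝ := fun a u => u * (a + |log u|)
  have hHeq : ∀ z : E × E, f₀ z.1 z.2 * (1 + ‖z.1‖ ^ 2 + ‖z.2‖ ^ 2 + |log (f₀ z.1 z.2)|) =
      G (w z) (f₀ z.1 z.2) := fun z => by simp only [G, hw]
  set H' : E × E → ℝ := hI.1.mk _ with hH'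
  have hH'm : Measurable H' := hI.1.stronglyMeasurable_mk.measurable
  have hHH' : ∀ᵐ z ∂((volume : Measure E).prod volume), G (w z) (f₀ z.1 z.2) = H' z := by
    filter_upwards [hI.1.ae_eq_mk] with z hz
    rw [← hHeq z]; exact hz
  -- the Borel candidate: `sup` of the rationals `q ≥ 0` with `G_w(q) ≤ H'`
  set F : E × E → ℝ≥0∞ := fun z => ⨆ q : ℚ, if (0 ≤ (q : ℝ) ∧ G (w z) q ≤ H' z) then
    ENNReal.ofReal q else 0 with hF
  have hFm : Measurable F := by
    refine Measurable.iSup fun q => Measurable.ite ?_ measurable_const measurable_const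
    have hGm : Measurable fun z => G (w z) q := by
      simp only [G]
      exact measurable_const.mul (hwm.add measurable_const)
    have h1 : MeasurableSet {a : E × E | (0 : ℝ) ≤ (q : ℝ)} := measurableSet_le measurable_const measurable_const
    exact h1.inter (measurableSet_le hGm hH'm)
  refine ⟨fun z => (F z).toReal, hFm.ennreal_toReal.stronglyMeasurable, ?_⟩
  filter_upwards [hHH'] with z hz
  -- at such `z`, `F z = ofReal (f₀ z)`
  have hmono := strictMonoOn_entropyWeight (hw1 z)
  have hf0z : 0 ≤ f₀ z.1 z.2 := h0 _ _
  have hiff : ∀ q : ℚ, 0 ≤ (q : ℝ) → (G (w z) q ≤ H' z ↔ (q : ℝ) ≤ f₀ z.1 z.2) := by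
    intro q hq
    rw [← hz]
    exact hmono.le_iff_le hq hf0z
  have hFz : F z = ENNReal.ofReal (f₀ z.1 z.2) := by
    refine le_antisymm (iSup_le fun q => ?_) ?_
    · split_ifs with hq
      · exact ENNReal.ofReal_le_ofReal ((hiff q hq.1).1 hq.2)
      · exact bot_le
    · refine ENNReal.le_of_forall_pos_le_add fun ε hε _ => ?_
      rcases eq_or_lt_of_le hf0z with hzero | hpos
      · rw [← hzero, ENNReal.ofReal_zero]; exact bot_le
      obtain ⟨q, hq1, hq2⟩ := exists_rat_btwn (show max 0 (f₀ z.1 z.2 - ε) < f₀ z.1 z.2 from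
        max_lt hpos (by linarith [hε]))
      have hq0 : 0 ≤ (q : ℝ) := (le_max_left _ _).trans hq1.le
      have hqε : f₀ z.1 z.2 - ε ≤ q := (le_max_right _ _).trans hq1.le
      calc ENNReal.ofReal (f₀ z.1 z.2) ≤ ENNReal.ofReal (q + ε) := ENNReal.ofReal_le_ofReal (by linarith)
        _ = ENNReal.ofReal q + ε := by
            rw [ENNReal.ofReal_add hq0 (NNReal.coe_nonneg ε), ENNReal.ofReal_coe_nnreal]
        _ ≤ F z + ε := by
            refine add_le_add ?_ le_rfl
            refine le_iSup_of_le q ?_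
            rw [if_pos ⟨hq0, (hiff q hq0).2 hq2.le⟩]
  show f₀ z.1 z.2 = (F z).toReal
  rw [hFz, ENNReal.toReal_ofReal hf0z]

end Literature.MathematicalPhysics.KineticTheory

namespace Literature.MathematicalPhysics.KineticTheory

variable {E : Type*} [NormedAddCommGroup E] [InnerProductSpace ℝ E] [FiniteDimensional ℝ E]
  [MeasurableSpace E] [BorelSpace E]

/-- The `L¹` distance of two integrable functions as the distance of their `L¹` classes. [folklore] -/
theorem dist_toL1_eq_integral_abs {α : Type*} [MeasurableSpace α] {μ : Measure α} {u v : α → ℝ}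
    (hu : Integrable u μ) (hv : Integrable v μ) :
    dist (hu.toL1 u) (hv.toL1 v) = ∫ x, |u x - v x| ∂μ := by
  rw [dist_edist, Integrable.edist_toL1_toL1]
  have h1 : ∫⁻ x, edist (u x) (v x) ∂μ = ∫⁻ x, ‖u x - v x‖ₑ ∂μ :=
    lintegral_congr fun x => edist_eq_enorm_sub _ _
  have hI : Integrable (fun x => u x - v x) μ := hu.sub hv
  rw [h1, ← integral_norm_eq_lintegral_enorm hI.1]
  rfl

/-- **Uniform `L¹`-continuity of the slice limits on compact time intervals** (Heine–Cantor for the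
continuous curve `t ↦ f_t ∈ L¹(E × E)` on `[0, T]`). [folklore] -/
theorem slice_limits_uniformly_continuous {ft : ℝ → E × E → ℝ}
    (hint : ∀ t ≥ (0 : ℝ), Integrable (ft t) (volume.prod volume))
    (hcont : ∀ t₀ ≥ (0 : ℝ), Tendsto (fun t => ∫ z : E × E, |ft t z - ft t₀ z| ∂(volume.prod volume))
      (𝓝[Ici 0] t₀) (𝓝 0))
    (T ε : ℝ) (hε : 0 < ε) :
    ∃ δ > (0 : ℝ), ∀ s ∈ Icc 0 T, ∀ t ∈ Icc 0 T, |s - t| < δ →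
      ∫ z : E × E, |ft s z - ft t z| ∂(volume.prod volume) < ε := by
  -- the curve in `L¹`, on the compact interval
  set Φ : Icc (0 : ℝ) T → (E × E →₁[(volume : Measure E).prod volume] ℝ) :=
    fun x => (hint x x.2.1).toL1 (ft x) with hΦ
  have hdist : ∀ x y : Icc (0 : ℝ) T, dist (Φ x) (Φ y) =
      ∫ z : E × E, |ft x z - ft y z| ∂(volume.prod volume) := fun x y =>
    dist_toL1_eq_integral_abs (hint x x.2.1) (hint y y.2.1)
  have hΦc : Continuous Φ := by
    refine continuous_iff_continuousAt.2 fun x₀ => ?_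
    rw [ContinuousAt, tendsto_iff_dist_tendsto_zero]
    simp only [hdist]
    have h1 := hcont x₀ x₀.2.1
    have h2 : Tendsto (fun x : Icc (0 : ℝ) T => (x : ℝ)) (𝓝 x₀) (𝓝[Ici 0] (x₀ : ℝ)) :=
      tendsto_nhdsWithin_iff.2 ⟨continuous_subtype_val.continuousAt,
        Eventually.of_forall fun x => x.2.1⟩
    exact h1.comp h2
  have hΦu : UniformContinuous Φ := CompactSpace.uniformContinuous_of_continuous hΦc
  rw [Metric.uniformContinuous_iff] at hΦu
  obtain ⟨δ, hδ, H⟩ := hΦu ε hε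
  refine ⟨δ, hδ, fun s hs t ht hst => ?_⟩
  have := H (a := ⟨s, hs⟩) (b := ⟨t, ht⟩) (by
    rw [Subtype.dist_eq, Real.dist_eq]; exact hst)
  rwa [hdist] at this

/-- **The slice at time `0` of the weak limit is the datum** (Lions 1993 Rem. III.8: "`f(0)` is the
weak limit in `L¹` of `fⁿ(0)`"): if `fⁿ(0) → f₀` strongly in `L¹` (`IsDiPernaLionsDataApproximation`)
and a subsequence of the slices at `0` converges weakly to `g₀`, then `g₀ = f₀` a.e. [cite: Lions1993Kinetic, Rem. III.8 (p. 57)] -/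
theorem slice_zero_ae_eq_data {f₀ : E → E → ℝ} (hf₀ : Literature.Analysis.FluidPDE.HasDiPernaLionsData f₀)
    (hf₀m : AEStronglyMeasurable (fun z : E × E => f₀ z.1 z.2) (volume.prod volume))
    {fseq : ℕ → ℝ → E → E → ℝ} (hdata : IsDiPernaLionsDataApproximation f₀ (fun n => fseq n 0))
    (hint : ∀ n, Integrable (fun z : E × E => fseq n 0 z.1 z.2) (volume.prod volume))
    {φ : ℕ → ℕ} (hφ : StrictMono φ) {g₀ : E × E → ℝ} (hg₀ : Integrable g₀ (volume.prod volume))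
    (hw : Literature.Analysis.FunctionSpaces.TendstoWeaklyL1 (fun k (z : E × E) => fseq (φ k) 0 z.1 z.2) g₀ (volume.prod volume)) :
    g₀ =ᵐ[(volume : Measure E).prod volume] fun z => f₀ z.1 z.2 := by
  haveI : SigmaFinite ((volume : Measure E).prod (volume : Measure E)) := inferInstance
  -- `f₀` is integrable
  have hf₀i : Integrable (fun z : E × E => f₀ z.1 z.2) (volume.prod volume) := by
    refine hf₀.2.mono hf₀m (ae_of_all _ fun z => ?_)
    rw [Real.norm_eq_abs, abs_of_nonneg (hf₀.1 _ _), Real.norm_eq_abs,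
      abs_of_nonneg (mul_nonneg (hf₀.1 _ _) (by positivity))]
    refine le_mul_of_one_le_right (hf₀.1 _ _) ?_
    nlinarith [sq_nonneg ‖z.1‖, sq_nonneg ‖z.2‖, abs_nonneg (log (f₀ z.1 z.2))]
  -- strong `L¹` convergence of the data implies weak convergence along the subsequence
  have hstrong : Tendsto (fun k => ∫ z : E × E, |fseq (φ k) 0 z.1 z.2 - f₀ z.1 z.2| ∂(volume.prod volume))
      atTop (𝓝 0) := by
    have h1 := hdata.tendsto_lintegral_sub.comp hφ.tendsto_atTop
    have h2 : ∀ k, ∫ z : E × E, |fseq (φ k) 0 z.1 z.2 - f₀ z.1 z.2| ∂(volume.prod volume) =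
        (∫⁻ z : E × E, ‖fseq (φ k) 0 z.1 z.2 - f₀ z.1 z.2‖ₑ ∂(volume.prod volume)).toReal := by
      intro k
      have hI : Integrable (fun z : E × E => fseq (φ k) 0 z.1 z.2 - f₀ z.1 z.2) (volume.prod volume) :=
        (hint (φ k)).sub hf₀i
      rw [← integral_norm_eq_lintegral_enorm hI.1]
      rfl
    simp only [h2]
    rw [← ENNReal.toReal_zero]
    exact (ENNReal.tendsto_toReal ENNReal.zero_ne_top).comp h1
  have hw' : Literature.Analysis.FunctionSpaces.TendstoWeaklyL1 (fun k (z : E × E) => fseq (φ k) 0 z.1 z.2) (fun z => f₀ z.1 z.2)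
      (volume.prod volume) :=
    Literature.Analysis.FunctionSpaces.TendstoWeaklyL1.of_tendsto_integral_abs_sub (fun k => hint (φ k)) hf₀i hstrong
  exact hw.ae_eq hw' hg₀ hf₀i

end Literature.MathematicalPhysics.KineticTheory

namespace Literature.MathematicalPhysics.KineticTheory

variable {E : Type*} [NormedAddCommGroup E] [InnerProductSpace ℝ E] [FiniteDimensional ℝ E]
  [MeasurableSpace E] [BorelSpace E]

/-- Summable `L¹` errors give almost everywhere convergence. [folklore] -/
theorem ae_tendsto_of_lintegral_enorm_sub_le {α : Type*} [MeasurableSpace α] {μ : Measure α}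
    {u : ℕ → α → ℝ} {v : α → ℝ} (hu : ∀ j, AEStronglyMeasurable (u j) μ) (hv : AEStronglyMeasurable v μ)
    {a : ℕ → ℝ≥0∞} (ha : ∑' j, a j ≠ ∞) (hle : ∀ j, ∫⁻ x, ‖u j x - v x‖ₑ ∂μ ≤ a j) :
    ∀ᵐ x ∂μ, Tendsto (fun j => u j x) atTop (𝓝 (v x)) := by
  have hmeas : ∀ j, AEMeasurable (fun x => ‖u j x - v x‖ₑ) μ := fun j => ((hu j).sub hv).enorm
  have hsum : ∫⁻ x, ∑' j, ‖u j x - v x‖ₑ ∂μ ≠ ∞ := by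
    rw [lintegral_tsum hmeas]
    exact ne_top_of_le_ne_top ha (ENNReal.tsum_le_tsum hle)
  have hfin : ∀ᵐ x ∂μ, ∑' j, ‖u j x - v x‖ₑ < ∞ :=
    ae_lt_top' (AEMeasurable.tsum hmeas) hsum
  filter_upwards [hfin] with x hx
  have h0 : Tendsto (fun j => ‖u j x - v x‖ₑ) atTop (𝓝 0) :=
    ENNReal.tendsto_atTop_zero_of_tsum_ne_top hx.ne
  rw [tendsto_iff_norm_sub_tendsto_zero]
  have : Tendsto (fun j => (‖u j x - v x‖ₑ).toReal) atTop (𝓝 (0 : ℝ≥0∞).toReal) :=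
    (ENNReal.tendsto_toReal ENNReal.zero_ne_top).comp h0
  simpa using this

/-- **A jointly Borel representative of the slice limits with every slice exact** (the limit
density as a measurable function on phase space-time; averages are replaced here by dyadic
right-endpoint sampling of Borel representatives along a fast grid): given integrable, a.e.
nonnegative `f_t` depending uniformly `L¹`-continuously on `t` over compact time intervals, there is
a nonnegative jointly Borel `F` with `F(t, ·) = f_t` a.e. for EVERY `t ≥ 0`. [folklore] -/
theorem exists_measurable_representative {ft : ℝ → E × E → ℝ}
    (hint : ∀ t ≥ (0 : ℝ), Integrable (ft t) (volume.prod volume))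
    (hnn : ∀ t ≥ (0 : ℝ), 0 ≤ᵐ[(volume : Measure E).prod volume] ft t)
    (hunif : ∀ T ε : ℝ, 0 < ε → ∃ δ > (0 : ℝ), ∀ s ∈ Icc 0 T, ∀ t ∈ Icc 0 T, |s - t| < δ →
      ∫ z : E × E, |ft s z - ft t z| ∂(volume.prod volume) < ε) :
    ∃ F : ℝ → E → E → ℝ, Measurable (fun q : ℝ × E × E => F q.1 q.2.1 q.2.2) ∧
      (∀ t x v, 0 ≤ F t x v) ∧
      ∀ t ≥ (0 : ℝ), (fun z : E × E => F t z.1 z.2) =ᵐ[(volume : Measure E).prod volume] ft t := by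
  set μ : Measure (E × E) := volume.prod volume with hμ
  -- Borel, nonnegative representatives of the slices
  have hrep : ∀ t : ℝ, ∃ r : E × E → ℝ, Measurable r ∧ (∀ z, 0 ≤ r z) ∧ (0 ≤ t → r =ᵐ[μ] ft t) := by
    intro t
    by_cases ht : 0 ≤ t
    · refine ⟨fun z => max 0 ((hint t ht).1.mk (ft t) z), ?_, fun z => le_max_left _ _, fun _ => ?_⟩
      · exact measurable_const.max (hint t ht).1.stronglyMeasurable_mk.measurable
      · filter_upwards [(hint t ht).1.ae_eq_mk, hnn t ht] with z hz h0
        have h0' : 0 ≤ ft t z := h0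
        rw [← hz, max_eq_right h0']
    · exact ⟨fun _ => 0, measurable_const, fun _ => le_rfl, fun h => absurd h ht⟩
  choose rep hrepm hrep0 hrepae using hrep
  -- the dyadic grids
  set τ : ℕ → ℝ → ℝ := fun n t => (⌈t * (2 : ℝ) ^ n⌉ : ℝ) / (2 : ℝ) ^ n with hτ
  have hτge : ∀ n t, t ≤ τ n t := fun n t => by
    rw [hτ]; simp only []
    rw [le_div_iff₀ (by positivity)]
    exact Int.le_ceil _
  have hτlt : ∀ n t, τ n t < t + ((1 : ℝ) / 2) ^ n := fun n t => by
    rw [hτ]; simp only []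
    rw [div_lt_iff₀ (by positivity), add_mul, one_div, inv_pow, inv_mul_cancel₀ (by positivity)]
    exact Int.ceil_lt_add_one _
  -- the sampled functions are jointly measurable
  have hFn : ∀ n : ℕ, Measurable fun q : ℝ × E × E => rep (τ n q.1) q.2 := by
    intro n
    have hG : Measurable fun p : (E × E) × ℤ => rep ((p.2 : ℝ) / (2 : ℝ) ^ n) p.1 :=
      measurable_from_prod_countable_left fun k => by exact hrepm ((k : ℝ) / (2 : ℝ) ^ n)
    have hc : Measurable fun q : ℝ × E × E => (q.2, ⌈q.1 * (2 : ℝ) ^ n⌉) :=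
      measurable_snd.prodMk (Int.measurable_ceil.comp (measurable_fst.mul_const _))
    exact hG.comp hc
  -- the fast grid `N j` with `(1/2)^(N j) < δ_j`, `δ_j` the uniform continuity modulus on `[0, j+1]`
  have hδ : ∀ j : ℕ, ∃ N : ℕ, ∀ s ∈ Icc (0 : ℝ) (j + 1), ∀ t ∈ Icc (0 : ℝ) (j + 1),
      |s - t| < ((1 : ℝ) / 2) ^ N → ∫ z, |ft s z - ft t z| ∂μ < ((1 : ℝ) / 2) ^ j := by
    intro j
    obtain ⟨δ, hδpos, H⟩ := hunif (j + 1) (((1 : ℝ) / 2) ^ j) (by positivity)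
    obtain ⟨N, hN⟩ := exists_pow_lt_of_lt_one hδpos (by norm_num : (1 : ℝ) / 2 < 1)
    exact ⟨N, fun s hs t ht hst => H s hs t ht (hst.trans hN)⟩
  choose N hN using hδ
  -- the representative
  set F : ℝ → E → E → ℝ := fun t x v =>
    (liminf (fun j => ENNReal.ofReal (rep (τ (N j) t) (x, v))) atTop).toReal with hFdef
  have hFm : Measurable fun q : ℝ × E × E => F q.1 q.2.1 q.2.2 := by
    have : Measurable fun q : ℝ × E × E =>
        liminf (fun j => ENNReal.ofReal (rep (τ (N j) q.1) q.2)) atTop :=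
      Measurable.liminf fun j => (hFn (N j)).ennreal_ofReal
    exact this.ennreal_toReal
  refine ⟨F, hFm, fun t x v => ENNReal.toReal_nonneg, fun t ht => ?_⟩
  -- `L¹` errors along the fast grid at time `t`, from `j ≥ ⌈t⌉₊` on
  set j₀ : ℕ := ⌈t⌉₊ with hj₀
  have herr : ∀ j : ℕ, ∫⁻ z, ‖rep (τ (N (j + j₀)) t) z - ft t z‖ₑ ∂μ ≤
      ENNReal.ofReal (((1 : ℝ) / 2) ^ (j + j₀)) := by
    intro j
    set s : ℝ := τ (N (j + j₀)) t with hs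
    have hs0 : 0 ≤ s := ht.trans (hτge _ _)
    have htj : t ≤ (j + j₀ : ℕ) := by
      have := Nat.le_ceil t
      push_cast
      linarith [(Nat.cast_nonneg j : (0 : ℝ) ≤ j)]
    have hsI : s ∈ Icc (0 : ℝ) ((j + j₀ : ℕ) + 1) := by
      refine ⟨hs0, ?_⟩
      have h1 := hτlt (N (j + j₀)) t
      have h2 : ((1 : ℝ) / 2) ^ N (j + j₀) ≤ 1 := pow_le_one₀ (by norm_num) (by norm_num)
      rw [hs]; linarith
    have htI : t ∈ Icc (0 : ℝ) ((j + j₀ : ℕ) + 1) := ⟨ht, by linarith⟩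
    have hst : |s - t| < ((1 : ℝ) / 2) ^ N (j + j₀) := by
      rw [abs_of_nonneg (by linarith [hτge (N (j + j₀)) t])]
      linarith [hτlt (N (j + j₀)) t]
    have key := hN (j + j₀) s hsI t htI hst
    have hI : Integrable (fun z => rep s z - ft t z) μ :=
      ((hint s hs0).congr (hrepae s hs0).symm).sub (hint t ht)
    rw [← ofReal_integral_norm_eq_lintegral_enorm hI]
    refine ENNReal.ofReal_le_ofReal (le_of_lt (lt_of_le_of_lt (le_of_eq ?_) key))
    refine integral_congr_ae ((hrepae s hs0).mono fun z hz => ?_)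
    simp only [Real.norm_eq_abs, hz]
  -- a.e. convergence of the sampled values at time `t`
  have hsum : ∑' j : ℕ, ENNReal.ofReal (((1 : ℝ) / 2) ^ (j + j₀)) ≠ ∞ := by
    have hpos : ∀ j : ℕ, 0 ≤ ((1 : ℝ) / 2) ^ (j + j₀) := fun j => by positivity
    have : ∑' j : ℕ, ENNReal.ofReal (((1 : ℝ) / 2) ^ (j + j₀)) =
        ENNReal.ofReal (∑' j : ℕ, ((1 : ℝ) / 2) ^ (j + j₀)) :=
      (ENNReal.ofReal_tsum_of_nonneg hpos
        ((summable_geometric_of_lt_one (by norm_num) (by norm_num)).comp_injective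
          (add_left_injective j₀))).symm
    rw [this]; exact ENNReal.ofReal_ne_top
  have hae := ae_tendsto_of_lintegral_enorm_sub_le (μ := μ)
    (fun j => (hrepm _).aestronglyMeasurable) (hint t ht).1 hsum herr
  filter_upwards [hae, hnn t ht] with z hz hz0
  -- at such `z`: the liminf is the limit
  have h1 : Tendsto (fun j => ENNReal.ofReal (rep (τ (N j) t) z)) atTop (𝓝 (ENNReal.ofReal (ft t z))) := by
    have := (ENNReal.continuous_ofReal.tendsto _).comp hz
    rw [Function.comp_def] at this
    exact (tendsto_add_atTop_iff_nat j₀).1 this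
  show F t z.1 z.2 = ft t z
  simp only [hFdef]
  rw [h1.liminf_eq, ENNReal.toReal_ofReal hz0]

end Literature.MathematicalPhysics.KineticTheory


namespace Literature.MathematicalPhysics.KineticTheory

open MeasureTheory Metric Real Set Filter Topology
open scoped InnerProductSpace ENNReal

section Assembly

universe u

variable {E : Type u} [NormedAddCommGroup E] [InnerProductSpace ℝ E] [FiniteDimensional ℝ E]
  [MeasurableSpace E] [BorelSpace E]

/-- The Gaussian `e^{-|x|²-|v|²-1}` has finite integral on `E × E`. [folklore] -/
theorem lintegral_exp_neg_sq_lt_top :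
    ∫⁻ z : E × E, ENNReal.ofReal (exp (-(‖z.1‖ ^ 2 + ‖z.2‖ ^ 2) - 1))
      ∂((volume : Measure E).prod volume) < ∞ := by
  have h1 : Integrable (fun v : E => exp (-1 * ‖v‖ ^ 2)) := Literature.Analysis.FluidPDE.integrable_exp_neg_mul_sq_norm one_pos
  have h2 : Integrable (fun z : E × E => exp (-1 * ‖z.1‖ ^ 2) * exp (-1 * ‖z.2‖ ^ 2))
      ((volume : Measure E).prod volume) := h1.mul_prod h1
  have h3 : Integrable (fun z : E × E => exp (-(‖z.1‖ ^ 2 + ‖z.2‖ ^ 2) - 1))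
      ((volume : Measure E).prod volume) := by
    refine (h2.mul_const (exp (-1))).congr (ae_of_all _ fun z => ?_)
    beta_reduce
    rw [← Real.exp_add, ← Real.exp_add]
    congr 1; ring
  rw [← ofReal_integral_eq_lintegral_ofReal h3 (ae_of_all _ fun z => (exp_pos _).le)]
  exact ENNReal.ofReal_lt_top

/-- **Assembly of (B1)** (`Kinetic.diPernaLions_extraction`; CIP 1994 §5.3 Step 10, pp. 151–152)
from the Dunford–Pettis theorem (`Literature.Analysis.FunctionSpaces.dunfordPettis_exists_subseq`) and the uniform-in-`n` time
equicontinuity of the approximate solutions along characteristics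
(`Kinetic.diPernaLions_approx_equicontinuous`): Cantor diagonal extraction of a subsequence
converging weakly on every slab, convergence of the slice pairings, slice weak limits, their
`L¹`-continuity in time, a jointly Borel representative with exact slices, the mass–moment–entropy
bound (3.32) by lower semicontinuity, and the identification of the slice at `t = 0` with `f₀`. [cite: CIPDiluteGases1994, §5.3 Step 10 (pp. 151–152)] -/
theorem diPernaLions_extraction_of (hDP : Literature.Analysis.FunctionSpaces.dunfordPettis_exists_subseq.{u})
    (hEQ : diPernaLions_approx_equicontinuous.{u}) : diPernaLions_extraction.{u} := by
  intro E _ _ _ _ _ B hB f₀ hf₀ δ Bseq fseq hδ hanti hlim hker hdata hsol hbd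
  -- (1) a subsequence converging weakly on every slab, and the glued slab limit
  obtain ⟨φ, hφ, hslabN⟩ := exists_subseq_tendstoWeaklyL1_slabs hDP hsol hbd
  choose gN hgNint hgNw using hslabN
  obtain ⟨g, hg⟩ := exists_glue_slab_limits hgNint hgNw
  -- data of the subsequence
  set fs : ℕ → ℝ → E → E → ℝ := fun k => fseq (φ k) with hfs
  have hcont : ∀ k, ContinuousOn (fun z : ℝ × E × E => fs k z.1 z.2.1 z.2.2) (Ici 0 ×ˢ univ) :=
    fun k => (hsol (φ k)).continuousOn_uncurry
  have hnn : ∀ k, ∀ t ≥ (0 : ℝ), ∀ x v, 0 ≤ fs k t x v := fun k t ht x v => (hsol (φ k)).nonneg t ht x v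
  have hmassC : ∀ T ≥ (0 : ℝ), ∃ C : ℝ, 0 ≤ C ∧ ∀ n, ∀ t ∈ Icc 0 T,
      ∫⁻ z : E × E, ENNReal.ofReal (fseq n t z.1 z.2 *
        (1 + ‖z.1‖ ^ 2 + ‖z.2‖ ^ 2 + |log (fseq n t z.1 z.2)|)) ∂((volume : Measure E).prod volume) ≤
        ENNReal.ofReal C := by
    intro T hT
    obtain ⟨C, hC⟩ := hbd.massEntropy_le T hT
    exact ⟨max C 0, le_max_right _ _, fun n t ht => (hC n t ht).trans
      (ENNReal.ofReal_le_ofReal (le_max_left _ _))⟩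
  have hmass : ∀ T ≥ (0 : ℝ), ∃ M : ℝ, ∀ k, ∀ t ∈ Icc 0 T,
      ∫⁻ z, ENNReal.ofReal (fs k t z.1 z.2) ∂((volume : Measure E).prod volume) ≤ ENNReal.ofReal M := by
    intro T hT
    obtain ⟨C, _, hC⟩ := hmassC T hT
    refine ⟨C, fun k t ht => le_trans (lintegral_mono fun z => ENNReal.ofReal_le_ofReal ?_) (hC (φ k) t ht)⟩
    refine le_mul_of_one_le_right (hnn k t ht.1 _ _) ?_
    nlinarith [sq_nonneg ‖z.1‖, sq_nonneg ‖z.2‖, abs_nonneg (log (fseq (φ k) t z.1 z.2))]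
  have heq : ∀ T ≥ (0 : ℝ), ∀ ε > (0 : ℝ), ∃ h₀ > (0 : ℝ), ∀ k, ∀ t ∈ Icc 0 T, ∀ h ∈ Icc 0 h₀,
      ∫⁻ z : E × E, ‖alongFreeFlow (fs k) (t + h) z.1 z.2 - alongFreeFlow (fs k) t z.1 z.2‖ₑ
        ∂((volume : Measure E).prod volume) ≤ ENNReal.ofReal ε := by
    intro T hT ε hε
    obtain ⟨h₀, hh₀, H⟩ := hEQ hB hf₀ hδ hanti hlim hker hdata hsol hbd T hT ε hε
    exact ⟨h₀, hh₀, fun k t ht h hh => H (φ k) t ht h hh⟩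
  -- (2) the slice pairings converge; (3) slice weak limits
  have hsl : ∀ t : ℝ, 0 ≤ t → ∃ ft : E × E → ℝ, Integrable ft (volume.prod volume) ∧
      Literature.Analysis.FunctionSpaces.TendstoWeaklyL1 (fun k (z : E × E) => fs k t z.1 z.2) ft (volume.prod volume) := by
    intro t ht
    have hpair := fun ψ C hψm hC => tendsto_slice_pairing_of_equicontinuous hcont hnn hmass
      (fun T => (hg T).2) heq ht hψm hC (ψ := ψ) (C := C)
    obtain ⟨hUI, hUT⟩ := uniformIntegrable_unifTight_slice hsol hbd φ ht
    exact exists_slice_weak_limit hDP hpair hUI hUT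
  choose! ft hftint hftw using hsl
  have hftnn : ∀ t ≥ (0 : ℝ), 0 ≤ᵐ[(volume : Measure E).prod volume] ft t := fun t ht =>
    (hftw t ht).ae_nonneg (fun k => ae_of_all _ fun z => hnn k t ht _ _) (hftint t ht)
  -- (4) continuity in time of the slice limits
  have hsharp : ∀ T ≥ (0 : ℝ), ∀ ε > (0 : ℝ), ∃ h₀ > (0 : ℝ), ∀ t ∈ Icc 0 T, ∀ h ∈ Icc 0 h₀,
      ∫⁻ z : E × E, ‖ft (t + h) (z.1 + (t + h) • z.2, z.2) - ft t (z.1 + t • z.2, z.2)‖ₑ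
        ∂((volume : Measure E).prod volume) ≤ ENNReal.ofReal ε := fun T hT ε hε =>
    sharp_slice_limits_equicontinuous hcont hnn hmass (fun t ht => ⟨hftint t ht, hftw t ht⟩) heq T hT ε hε
  have hcts := slice_limits_continuous hftint hsharp
  have hunif := slice_limits_uniformly_continuous hftint hcts
  -- (5) the Borel representative
  obtain ⟨F, hFm, hF0, hFae⟩ := exists_measurable_representative hftint hftnn hunif
  have hsliceF : ∀ t ≥ (0 : ℝ), Literature.Analysis.FunctionSpaces.TendstoWeaklyL1 (fun k (z : E × E) => fs k t z.1 z.2)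
      (fun z => F t z.1 z.2) (volume.prod volume) := fun t ht =>
    (hftw t ht).congr_limit (hFae t ht).symm
  have hFint : ∀ t ≥ (0 : ℝ), Integrable (fun z : E × E => F t z.1 z.2) (volume.prod volume) :=
    fun t ht => (hftint t ht).congr (hFae t ht).symm
  -- (6) the mass–moment–entropy bound for the slices of `F`
  have hFmassEntropy : ∀ T ≥ (0 : ℝ), ∃ C : ℝ, ∀ t ∈ Icc 0 T,
      ∫⁻ z : E × E, ENNReal.ofReal (F t z.1 z.2 *
        (1 + ‖z.1‖ ^ 2 + ‖z.2‖ ^ 2 + |log (F t z.1 z.2)|)) ∂((volume : Measure E).prod volume) ≤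
        ENNReal.ofReal C := by
    intro T hT
    obtain ⟨C, hC0, hC⟩ := hmassC T hT
    set D : ℝ≥0∞ := ∫⁻ z : E × E, ENNReal.ofReal (exp (-(‖z.1‖ ^ 2 + ‖z.2‖ ^ 2) - 1))
      ∂((volume : Measure E).prod volume) with hD
    have hDtop : D ≠ ∞ := lintegral_exp_neg_sq_lt_top.ne
    refine ⟨C + C + (C + D.toReal), fun t ht => ?_⟩
    have key := lintegral_massEntropy_le_of_tendstoWeaklyL1 (hftw t ht.1)
      (fun k z => hnn k t ht.1 _ _) (fun k => (hsol (φ k)).integrable_slice t ht.1) (hftint t ht.1)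
      (fun k => hC (φ k) t ht)
    calc ∫⁻ z : E × E, ENNReal.ofReal (F t z.1 z.2 *
          (1 + ‖z.1‖ ^ 2 + ‖z.2‖ ^ 2 + |log (F t z.1 z.2)|)) ∂((volume : Measure E).prod volume)
        = ∫⁻ z : E × E, ENNReal.ofReal (ft t z *
          (1 + ‖z.1‖ ^ 2 + ‖z.2‖ ^ 2 + |log (ft t z)|)) ∂((volume : Measure E).prod volume) :=
          lintegral_congr_ae ((hFae t ht.1).mono fun z hz => by beta_reduce; rw [show F t z.1 z.2 = ft t z from hz])
      _ ≤ ENNReal.ofReal C + ENNReal.ofReal C + (ENNReal.ofReal C + D) := key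
      _ = ENNReal.ofReal (C + C + (C + D.toReal)) := by
          rw [ENNReal.ofReal_add (by positivity) (by positivity), ENNReal.ofReal_add hC0 hC0,
            ENNReal.ofReal_add hC0 ENNReal.toReal_nonneg, ENNReal.ofReal_toReal hDtop]
  have hFmass : ∀ T ≥ (0 : ℝ), ∃ M : ℝ, ∀ t ∈ Icc 0 T,
      ∫⁻ z, ENNReal.ofReal (F t z.1 z.2) ∂((volume : Measure E).prod volume) ≤ ENNReal.ofReal M := by
    intro T hT
    obtain ⟨C, hC⟩ := hFmassEntropy T hT
    refine ⟨C, fun t ht => le_trans (lintegral_mono fun z => ENNReal.ofReal_le_ofReal ?_) (hC t ht)⟩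
    refine le_mul_of_one_le_right (hF0 _ _ _) ?_
    nlinarith [sq_nonneg ‖z.1‖, sq_nonneg ‖z.2‖, abs_nonneg (log (F t z.1 z.2))]
  -- (7) weak convergence on every slab
  have hslabF : ∀ T : ℝ, Literature.Analysis.FunctionSpaces.TendstoWeaklyL1 (fun k (q : ℝ × E × E) => fs k q.1 q.2.1 q.2.2)
      (fun q => F q.1 q.2.1 q.2.2) (slabMeasure E T) :=
    tendstoWeaklyL1_slab_of_slices hcont hnn hmass hFm (fun t _ x v => hF0 t x v) hFmass hsliceF
  -- (8) the slice at `t = 0`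
  have hf₀m := hf₀.aestronglyMeasurable
  have hzero : ft 0 =ᵐ[(volume : Measure E).prod volume] fun z => f₀ z.1 z.2 :=
    slice_zero_ae_eq_data hf₀ hf₀m hdata (fun n => (hsol n).integrable_slice 0 le_rfl) hφ
      (hftint 0 le_rfl) (hftw 0 le_rfl)
  -- assemble
  refine ⟨φ, F, ⟨hφ, fun t ht x v => hF0 t x v, hFm, hslabF, hsliceF, ?_, ?_, hFmassEntropy⟩⟩
  · exact (hFae 0 le_rfl).trans hzero
  · intro t₀ ht₀
    have h1 := hcts t₀ ht₀
    refine h1.congr' ?_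
    filter_upwards [self_mem_nhdsWithin] with t ht
    refine integral_congr_ae ?_
    filter_upwards [hFae t ht, hFae t₀ ht₀] with z hz hz₀
    rw [show F t z.1 z.2 = ft t z from hz, show F t₀ z.1 z.2 = ft t₀ z from hz₀]

/-- **(B1) from the equicontinuity fact alone**: with the Dunford–Pettis theorem proved
(`Literature.Analysis.FunctionSpaces.dunfordPettis_exists_subseq_holds`), `Kinetic.diPernaLions_extraction` follows from
`Kinetic.diPernaLions_approx_equicontinuous` (CIP 1994 §5.3 Step 10). [cite: CIPDiluteGases1994, §5.3 Step 10 (pp. 151–152)] -/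
theorem diPernaLions_extraction_of_equicontinuous (hEQ : diPernaLions_approx_equicontinuous.{u}) :
    diPernaLions_extraction.{u} :=
  diPernaLions_extraction_of Literature.Analysis.FunctionSpaces.dunfordPettis_exists_subseq_holds hEQ

end Assembly

end Literature.MathematicalPhysics.KineticTheory

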